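import Summits.QuantumFields.YangMills.Theorems.UnitScaleTiltProp7RowsHOfOffsetFamily
import Summits.QuantumFields.YangMills.Theorems.UnitScaleTiltProp7RowPOfFaceFluxRows
import Summits.QuantumFields.YangMills.Theorems.UnitScaleTiltProp7ZetaRowOfEngineRowsAbs
import HarnessLib

/-!
# Route `UnitScaleTilt`, crux K1 child «MinimiserStabilityRegPr» (stmt-QuantumFields-19200) — route-R E′, growth side: THE MEMBER-LEVEL COMPOSITION CHECK OF THE K-FORM ENGINE.
# For a member with the offset-family window `(2ℓ + ℓ′)·2 < N₀`: the three rows (H) (P′) (B) demanded per member by the R5 door v2 ✓`Prop7ZetaRowOfEngineRowsAbs` follow, BY KERNEL,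
# from the DISPLAYED raw rows hKg-K (local alignment), hKg′-K(R4′-fam), hLap, hKg′(site), hJunc (the (H)-funnel of routeR-w1 ✓p682294 ∕ w4 ✓p680955) and hXb, hq (px5 ✓p680744)

Cell `ym3-torus` ∕ fleet seat `ym-ust-19200-p1` (gen 16, route-R E′ lead ∕ namer).  THEOREMS ONLY (0 `def`, 0 `sorry`); `--supports stmt-QuantumFields-19200`, count-neutral.
YM₃ on T³ is a ladder rung (R3), not the Clay problem; nothing here claims the stub, the crux, d = 4 or the mass gap; every raw row is DISPLAYED.

WHY.  The night's knits descend E′'s growth side to raw rows through four seats' files: ✓p680452 (E′ ⟸ (E1) ∧ hKg-K ∧ ∃Ψ-rows ∧ (P′)), ✓p682294 (∃Ψ-rows ⟸ the offset family's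
hKg′-K(fam) ∧ hLap ∧ hKg′(site) ∧ hJunc, routeR-w1), ✓p680955 (hRes ⟸ hLap ∧ hKg′(site) ∧ hDir, w4), ✓p680787 (hDir ⟸ family, routeR-w1), ✓p680744 ((P′) ⟸ hXb ∧ hq, px5),
✓p677648 ((B) ⟸ hKg-K, px12).  This file is the KERNEL CHECK that these letters compose at a member: one theorem whose hypotheses are the raw displayed rows in their authors'
letters VERBATIM (plus the member arithmetic and windows) and whose conclusion is LITERALLY the triple (H) ∧ (P′) ∧ (B) that ✓`zetaRow_of_engineRows_abs` consumes per member and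
per co-closed split, with the constants `ζ_H = 6(A₁Cg′ + A₂ζ_D) + ζ_D + ζ_G`, `θ_H = 6(A₁θg′ + A₂θ_D) + θ_D + θ_G`, free-θ `θ′ = θ + θ_q`, `ζ_P = ζ_X·(θ + θ_q)∕θ`, px5's
`θ_P, C_P = C_X + 8, C_Λ = 19200L⁴, η = η_X + η_q`, px12's `ζ_B = 16(1+C_g)`, `θ_B = 16θ_g + 792`.  The small members (`(2ℓ + ℓ′)·2 ≥ N₀`, i.e. `L^(m+n) ≤ 3`) keep the ∃Ψ-rows
displayed (routeR-w3's small-torus branch).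

WHAT IS PROVED (ns `…Theorems.Prop7EngineRowsOfRawRows`): ★★★ `engineRows_of_rawRows` (member level).
HONEST SCOPE.  Composition of landed theorems; the raw rows hKg-K ∕ hKg′-K(fam) ∕ hLap ∕ hKg′(site) ∕ hJunc ∕ hXb ∕ hq are DISPLAYED (numerically inhabited at ℓ = 3, 5: (N1), (N3));
no constant of Bałaban's is asserted.

References: T. Bałaban, CMP 102 (1985) 277–309 [Balaban1985Variational] ((4)–(7) p.278, (47)–(48) pp.285–286, (116) p.295, (141)–(143), Prop. 7 p.299); CMP 99 (1985) 389–434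
[Balaban1985BackgroundPropagators] ((3.3)–(3.4) pp.390–391, (3.8)–(3.11) p.392, Thm 3.11 p.416); CMP 95 (1984) 17–40 [Balaban1984PropagatorsI] ((1.18)–(1.21) pp.19–21, Prop. 1.1 p.33);
CMP 98 (1985) 17–51 [Balaban1985Averaging] ((9)–(13) pp.18–19, (19)–(21) p.21).
-/

set_option autoImplicit false

noncomputable section

open scoped BigOperators Matrix.Norms.L2Operator Matrix

namespace Summit.QuantumFields.YangMills.Theorems.Prop7EngineRowsOfRawRows

open Literature.MathematicalPhysics.QuantumFieldTheory.Balaban1983to89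
open Literature.MathematicalPhysics.QuantumFieldTheory.Balaban1983to89.T3ContinuumYM3Torus
open Finset T4Continuum T4ReflectionCone BlockAveraging AveragingRT ExpMeanLog BlockAveragingEMLLinearised BlockAveragingEMLLinearisedBackground
  BlockAveragingEMLProp2 B1RG242Torus
open B15DeterminingSets (embIter)
open B7Prop1Explicit (U1 treeWord Letter e seg hol)
open B7Eq78Linearization (conjR)
open B9Eq39Adjoint (R covD covDstar divB curl)
open B9TorusCalculus (torusT)
open B10Eq27TorusAxialLog (holT unitsField toUField axialT contourT rel pull transl)
open B5Eq118OneStroke (iterBlockOf)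
open Summit.QuantumFields.YangMills.Theorems.Prop7RowsHOfOffsetFamily (rowsH_of_offsetFamilyRows)
open Summit.QuantumFields.YangMills.Theorems.Prop7RowHOfLocalModelRowsPt (rowH_of_localModelRows_pt)
open Summit.QuantumFields.YangMills.Theorems.Prop7RowPOfFaceFluxRows (rowP_of_faceFluxRows)
open Summit.QuantumFields.YangMills.Theorems.Prop7CoclosedEnergiesOfHKgK (rowB_of_hKgK_T3)

set_option maxHeartbeats 800000 in
/-- ★★★ **THE MEMBER-LEVEL COMPOSITION CHECK: (H) ∧ (P′) ∧ (B) ⇐ the raw displayed rows.**  Member `(F, K, n)` with `K − n ≤ m + K`, `2 ≤ L^(K−n)`, the offset-family window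
`(2ℓ + ℓ′)·2 < N₀` and comb splits `s t`; background `W` with `dist1(W(∂p)) ≤ e·ℓ⁻²`, `0 < e ≤ 1`, `10⁶L⁵e ≤ 1`; a co-closed covariant Hodge split `D = B + D_Wφ₀` with `Δ_W²φ₀ = 0` off the
centres; the true linearised iterate `Q` (recursion displayed); bi-contractive junction transports `S`; `0 < θ`, `0 < θ + θ_q`.  DISPLAYED: hKg-K (px12's letter), hKg′-K(R4′-fam), hLap,
hKg′(site), hJunc (routeR-w1's ∕ w4's letters), hXb, hq (px5's letters).  CONCLUSION: rows (H), (P′), (B) of ✓`Prop7ZetaRowOfEngineRowsAbs.zetaRow_of_engineRows_abs` at this member ∕ split.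
[cite: Balaban1985Variational, (141)-(143) p.299, Prop. 7 p.299, (47)-(48) pp.285-286; Balaban1985BackgroundPropagators, (3.3)-(3.4) pp.390-391, (3.8)-(3.11) p.392, Thm 3.11 p.416; Balaban1984PropagatorsI, Prop. 1.1 (1.90) p.33; Balaban1985Averaging, (19)-(21) p.21] -/
theorem engineRows_of_rawRows (F : T3Family) (K n : ℕ) (hk : K - n ≤ (F.P K).m + (F.P K).K) (hℓ2 : 2 ≤ (F.P K).L ^ (K - n))
    (W : GaugeField (F.P K) 0 (Matrix.specialUnitaryGroup (Fin 2) ℂ))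
    (D B : PBond (F.P K) 0 → Matrix (Fin 2) (Fin 2) ℂ) (φ₀ : Site (F.P K) 0 → Matrix (Fin 2) (Fin 2) ℂ)
    (hsplit : ∀ b : PBond (F.P K) 0, D b = B b + covD (torusT (F.P K) 0) (fun κ z => unitsField (toUField W) ⟨z, κ⟩) b.dir φ₀ b.src)
    (hBc : ∀ x : Site (F.P K) 0, divB (torusT (F.P K) 0) (fun κ z => unitsField (toUField W) ⟨z, κ⟩) (fun κ z => B ⟨z, κ⟩) x = 0)
    (hψ : ∀ x : Site (F.P K) 0, x ∉ Set.range (embIter (K - n)) →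
      divB (torusT (F.P K) 0) (fun κ z => unitsField (toUField W) ⟨z, κ⟩) (fun κ y => covD (torusT (F.P K) 0) (fun κ z => unitsField (toUField W) ⟨z, κ⟩) κ
        (fun z => divB (torusT (F.P K) 0) (fun κ z => unitsField (toUField W) ⟨z, κ⟩) (fun ν w => covD (torusT (F.P K) 0) (fun κ z => unitsField (toUField W) ⟨z, κ⟩) ν φ₀ w) z) y) x = 0)
    {ee θ ζ_X θ_X C_X η_X θ_q η_q : ℝ} (he : 0 < ee) (heL : 1000000 * (F.L : ℝ) ^ 5 * ee ≤ 1)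
    (hW : ∀ p : Plaq (F.P K) 0, dist1 (GaugeField.plaqHol W p) ≤ ee * (((F.L : ℝ) ^ (K - n)) ^ 2)⁻¹)
    -- the true linearised iterate of record, displayed by its recursion (✓`exists_trueLinIter_family`)
    (Q : (k : ℕ) → (PBond (F.P K) 0 → Matrix (Fin 2) (Fin 2) ℂ) → PBond (F.P K) k → Matrix (Fin 2) (Fin 2) ℂ) (hQ0 : ∀ Y, Q 0 Y = Y)
    (hQs : ∀ (k : ℕ) (Y : PBond (F.P K) 0 → Matrix (Fin 2) (Fin 2) ℂ) (c : PBond (F.P K) (k + 1)), Q (k + 1) Y c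
      = fderiv ℂ (eml : (Idx (F.P K) → Matrix (Fin 2) (Fin 2) ℂ) → Matrix (Fin 2) (Fin 2) ℂ)
            (fun i => ((loopHol (Averaging.iter (fun i => blockAvg (P := F.P K) (j := i) (expMeanLogSU (n := Fin 2))) k W) c i :
              Matrix.specialUnitaryGroup (Fin 2) ℂ) : Matrix (Fin 2) (Fin 2) ℂ))
            (fun i => covWalkSum (Averaging.iter (fun i => blockAvg (P := F.P K) (j := i) (expMeanLogSU (n := Fin 2))) k W) (Q k Y)
                (walk (emb c.src) (loopWord (F.P K).L c.dir (off i.1) i.2.1 i.2.2))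
              * ((loopHol (Averaging.iter (fun i => blockAvg (P := F.P K) (j := i) (expMeanLogSU (n := Fin 2))) k W) c i :
                Matrix.specialUnitaryGroup (Fin 2) ℂ) : Matrix (Fin 2) (Fin 2) ℂ))
            * star ((corr (expMeanLogSU (n := Fin 2)) (Averaging.iter (fun i => blockAvg (P := F.P K) (j := i) (expMeanLogSU (n := Fin 2))) k W) c :
                Matrix.specialUnitaryGroup (Fin 2) ℂ) : Matrix (Fin 2) (Fin 2) ℂ)
          + ((corr (expMeanLogSU (n := Fin 2)) (Averaging.iter (fun i => blockAvg (P := F.P K) (j := i) (expMeanLogSU (n := Fin 2))) k W) c :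
                Matrix.specialUnitaryGroup (Fin 2) ℂ) : Matrix (Fin 2) (Fin 2) ℂ)
            * covWalkSum (Averaging.iter (fun i => blockAvg (P := F.P K) (j := i) (expMeanLogSU (n := Fin 2))) k W) (Q k Y)
                (walk (emb c.src) (List.replicate (F.P K).L (c.dir, true)))
            * star ((corr (expMeanLogSU (n := Fin 2)) (Averaging.iter (fun i => blockAvg (P := F.P K) (j := i) (expMeanLogSU (n := Fin 2))) k W) c :
                Matrix.specialUnitaryGroup (Fin 2) ℂ) : Matrix (Fin 2) (Fin 2) ℂ))
    -- ▢ hq — THE FIBRE-DEFECT ROW (pointwise second order along the averaging paths; routeR-w2): `8·Σ_c‖Q^{(K−n)}D(c)‖² ≤ θ_q·ℓ⁻¹·M + η_q·ℓ·DIV(D)`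
    (hq : 8 * ∑ c : PBond (F.P K) (K - n), ‖Q (K - n) D c‖ ^ 2 ≤ θ_q * ((F.L : ℝ) ^ (K - n))⁻¹ * (∑ b : PBond (F.P K) 0, ‖D b‖ ^ 2)
        + η_q * ((F.L : ℝ) ^ (K - n)) * (∑ x : Site (F.P K) 0, ∑ j : Fin 2, ∑ k : Fin 2,
              ‖(divB (torusT (F.P K) 0) (fun κ z => unitsField (toUField W) ⟨z, κ⟩) (fun κ z => Complex.I • D ⟨z, κ⟩) x) j k‖ ^ 2))
    -- ▢ hXb — THE GAUSS COMPOSITE (px17: BLOCK-GAUSS + FACE∕FACE′ + Σ₁ + J_VH), FACE = per-line face functional of `B` at the far-face crossing, centre frame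
    (hXb : 2 * |∑ c : PBond (F.P K) (K - n), (((φ₀ (embIter (K - n) c.src)
          - ((Averaging.iter (fun i => blockAvg (P := F.P K) (j := i) (expMeanLogSU (n := Fin 2))) (K - n) W c : Matrix.specialUnitaryGroup (Fin 2) ℂ) : Matrix (Fin 2) (Fin 2) ℂ)
              * φ₀ (embIter (K - n) c.tgt)
              * star ((Averaging.iter (fun i => blockAvg (P := F.P K) (j := i) (expMeanLogSU (n := Fin 2))) (K - n) W c : Matrix.specialUnitaryGroup (Fin 2) ℂ) : Matrix (Fin 2) (Fin 2) ℂ))ᴴ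
          * ((((((F.P K).L : ℝ) ^ (K - n)) ^ (F.P K).d)⁻¹ •
              (((holAt W (walk (embIter (K - n) c.src) (treeWord fun _ : Fin (F.P K).d => -((((F.P K).L ^ (K - n) - 1) / 2 : ℕ) : ℤ))) : Matrix.specialUnitaryGroup (Fin 2) ℂ) :
                  Matrix (Fin 2) (Fin 2) ℂ)
                * ((((F.P K).L : ℝ) ^ (K - n)) • ∑ r : Fin (F.P K).d → Fin ((F.P K).L ^ (K - n)),
                    conjR (holT (unitsField (toUField W)) (Site.fibreSite 0 (K - n) c.src fun _ => ⟨0, pow_pos (F.P K).L_pos (K - n)⟩) (treeWord fun ν => ((r ν : ℕ) : ℤ))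
                        * holT (unitsField (toUField W)) (Site.fibreSite 0 (K - n) c.src r) (List.replicate ((F.P K).L ^ (K - n) - 1 - (r c.dir : ℕ)) (c.dir, true)))
                      (B ⟨(fun z : Site (F.P K) 0 => z.shift c.dir)^[(F.P K).L ^ (K - n) - 1 - (r c.dir : ℕ)] (Site.fibreSite 0 (K - n) c.src r), c.dir⟩))
                * star (((holAt W (walk (embIter (K - n) c.src) (treeWord fun _ : Fin (F.P K).d => -((((F.P K).L ^ (K - n) - 1) / 2 : ℕ) : ℤ))) : Matrix.specialUnitaryGroup (Fin 2) ℂ) :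
                  Matrix (Fin 2) (Fin 2) ℂ)))))).trace).re|
      ≤ ((F.L : ℝ) ^ (K - n)) * (ζ_X / θ) * (∑ p : Plaq (F.P K) 0, ‖((Complex.I • D ⟨p.src, p.μ⟩) + ((W ⟨p.src, p.μ⟩ : Matrix (Fin 2) (Fin 2) ℂ) * (Complex.I • D ⟨p.src.shift p.μ, p.ν⟩) * star (W ⟨p.src, p.μ⟩ : Matrix (Fin 2) (Fin 2) ℂ))
            - (((W ⟨p.src, p.μ⟩ * W ⟨p.src.shift p.μ, p.ν⟩ * (W ⟨p.src.shift p.ν, p.μ⟩)⁻¹ : Matrix.specialUnitaryGroup (Fin 2) ℂ) : Matrix (Fin 2) (Fin 2) ℂ) * (Complex.I • D ⟨p.src.shift p.ν, p.μ⟩) * star ((W ⟨p.src, p.μ⟩ * W ⟨p.src.shift p.μ, p.ν⟩ * (W ⟨p.src.shift p.ν, p.μ⟩)⁻¹ : Matrix.specialUnitaryGroup (Fin 2) ℂ) : Matrix (Fin 2) (Fin 2) ℂ))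
            - (((GaugeField.plaqHol W p : Matrix.specialUnitaryGroup (Fin 2) ℂ) : Matrix (Fin 2) (Fin 2) ℂ) * (Complex.I • D ⟨p.src, p.ν⟩) * star ((GaugeField.plaqHol W p : Matrix.specialUnitaryGroup (Fin 2) ℂ) : Matrix (Fin 2) (Fin 2) ℂ)))‖ ^ 2)
        + θ * ((F.L : ℝ) ^ (K - n))⁻¹ * (∑ b : PBond (F.P K) 0, ‖D b‖ ^ 2)
        + θ_X * ee * ((F.L : ℝ) ^ (K - n))⁻¹ * (∑ b : PBond (F.P K) 0, ‖D b‖ ^ 2)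
        + C_X * ((F.L : ℝ) ^ (K - n)) * (∑ b : PBond (F.P K) 0, ∑ ν : Fin (F.P K).d,
                ‖((W ⟨b.src, ν⟩ : Matrix.specialUnitaryGroup (Fin 2) ℂ) : Matrix (Fin 2) (Fin 2) ℂ) * B ⟨b.src.shift ν, b.dir⟩ * star ((W ⟨b.src, ν⟩ : Matrix.specialUnitaryGroup (Fin 2) ℂ) : Matrix (Fin 2) (Fin 2) ℂ) - B b‖ ^ 2)
        + η_X * ((F.L : ℝ) ^ (K - n)) * (∑ x : Site (F.P K) 0, ∑ j : Fin 2, ∑ k : Fin 2,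
              ‖(divB (torusT (F.P K) 0) (fun κ z => unitsField (toUField W) ⟨z, κ⟩) (fun κ z => Complex.I • D ⟨z, κ⟩) x) j k‖ ^ 2))
    (he1 : ee ≤ 1) (hθ : 0 < θ) (hθq0 : 0 < θ + θ_q)
    -- ▢ hKg-K at `IsCritR2 W` (px12's letter; DISPLAYED)
    {C_g θ_g : ℝ}
    (hKg : ∀ Dφ : PBond (F.P K) 0 → Matrix (Fin 2) (Fin 2) ℂ, (∀ b : PBond (F.P K) 0, Dφ b = covD (torusT (F.P K) 0) (fun κ z => unitsField (toUField W) ⟨z, κ⟩) b.dir φ₀ b.src) →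
      (∑ p : Plaq (F.P K) 0, ‖((Complex.I • Dφ ⟨p.src, p.μ⟩) + ((W ⟨p.src, p.μ⟩ : Matrix (Fin 2) (Fin 2) ℂ) * (Complex.I • Dφ ⟨p.src.shift p.μ, p.ν⟩) * star (W ⟨p.src, p.μ⟩ : Matrix (Fin 2) (Fin 2) ℂ))
            - (((W ⟨p.src, p.μ⟩ * W ⟨p.src.shift p.μ, p.ν⟩ * (W ⟨p.src.shift p.ν, p.μ⟩)⁻¹ : Matrix.specialUnitaryGroup (Fin 2) ℂ) : Matrix (Fin 2) (Fin 2) ℂ) * (Complex.I • Dφ ⟨p.src.shift p.ν, p.μ⟩) * star ((W ⟨p.src, p.μ⟩ * W ⟨p.src.shift p.μ, p.ν⟩ * (W ⟨p.src.shift p.ν, p.μ⟩)⁻¹ : Matrix.specialUnitaryGroup (Fin 2) ℂ) : Matrix (Fin 2) (Fin 2) ℂ))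
            - (((GaugeField.plaqHol W p : Matrix.specialUnitaryGroup (Fin 2) ℂ) : Matrix (Fin 2) (Fin 2) ℂ) * (Complex.I • Dφ ⟨p.src, p.ν⟩) * star ((GaugeField.plaqHol W p : Matrix.specialUnitaryGroup (Fin 2) ℂ) : Matrix (Fin 2) (Fin 2) ℂ)))‖ ^ 2)
      ≤ C_g * (∑ p : Plaq (F.P K) 0, ‖((Complex.I • D ⟨p.src, p.μ⟩) + ((W ⟨p.src, p.μ⟩ : Matrix (Fin 2) (Fin 2) ℂ) * (Complex.I • D ⟨p.src.shift p.μ, p.ν⟩) * star (W ⟨p.src, p.μ⟩ : Matrix (Fin 2) (Fin 2) ℂ))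
            - (((W ⟨p.src, p.μ⟩ * W ⟨p.src.shift p.μ, p.ν⟩ * (W ⟨p.src.shift p.ν, p.μ⟩)⁻¹ : Matrix.specialUnitaryGroup (Fin 2) ℂ) : Matrix (Fin 2) (Fin 2) ℂ) * (Complex.I • D ⟨p.src.shift p.ν, p.μ⟩) * star ((W ⟨p.src, p.μ⟩ * W ⟨p.src.shift p.μ, p.ν⟩ * (W ⟨p.src.shift p.ν, p.μ⟩)⁻¹ : Matrix.specialUnitaryGroup (Fin 2) ℂ) : Matrix (Fin 2) (Fin 2) ℂ))
            - (((GaugeField.plaqHol W p : Matrix.specialUnitaryGroup (Fin 2) ℂ) : Matrix (Fin 2) (Fin 2) ℂ) * (Complex.I • D ⟨p.src, p.ν⟩) * star ((GaugeField.plaqHol W p : Matrix.specialUnitaryGroup (Fin 2) ℂ) : Matrix (Fin 2) (Fin 2) ℂ)))‖ ^ 2)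
        + θ_g * ee * (((F.L : ℝ) ^ (K - n)) ^ 2)⁻¹ * (∑ b : PBond (F.P K) 0, ‖D b‖ ^ 2))
    -- ▢ the (H)-funnel of the offset family (routeR-w1's letters; hKgPfam ∕ hLap ∕ hKgP ∕ hJunc DISPLAYED)
    (ι : Fin (F.P K).d) (ℓ' : ℕ) [NeZero ℓ'] (hN : (2 * (F.P K).L ^ (K - n) + ℓ') * 2 < (F.P K).sitesPerDir 0)
    (s t : Fin (F.P K).d → List (Fin (F.P K).d)) (hsplit' : ∀ μ, (List.finRange (F.P K).d).reverse = s μ ++ μ :: t μ) (hs : ∀ μ, μ ∉ s μ) (ht : ∀ μ, μ ∉ t μ)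
    (S : Site (F.P K) (K - n) → Site (F.P K) 0 → (Matrix (Fin 2) (Fin 2) ℂ)ˣ)
    (hS : ∀ y z, ‖((S y z : (Matrix (Fin 2) (Fin 2) ℂ)ˣ) : Matrix (Fin 2) (Fin 2) ℂ)‖ ≤ 1 ∧ ‖(((S y z)⁻¹ : (Matrix (Fin 2) (Fin 2) ℂ)ˣ) : Matrix (Fin 2) (Fin 2) ℂ)‖ ≤ 1)
    {C_H ζ_D θ_D ζ_G θ_G a A₁ A₂ KGP Cg' θg' : ℝ} (hA₁ : 0 ≤ A₁) (hA₂ : 0 ≤ A₂)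
    (ha : a ^ 2 ≤ 2 * (3 * (2 * ((F.P K).d : ℝ) * (6 / ((((F.P K).L ^ (K - n) : ℕ) : ℝ)))) * (3 / ((((F.P K).L ^ (K - n) : ℕ) : ℝ)))))
    (hKgPfam : 2 * (3 * (2 * ((F.P K).d : ℝ) * (6 / ((((F.P K).L ^ (K - n) : ℕ) : ℝ)))) * (3 / ((((F.P K).L ^ (K - n) : ℕ) : ℝ))))
          * (∑ y : Site (F.P K) (K - n), (ℓ' : ℝ)⁻¹ * ∑ η : Fin ℓ', (2 * ∑ μ : Fin (F.P K).d,
              ((((t μ).length * (2 * (F.P K).L ^ (K - n) + ℓ') : ℕ) : ℝ) * ∑ i ∈ Finset.range (t μ).length, (((2 * (2 * (F.P K).L ^ (K - n) + ℓ') + 1) ^ ((t μ).length - i) : ℕ) : ℝ)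
                * ∑ q ∈ Fintype.piFinset (fun _ : Fin (F.P K).d => Finset.Icc (-((2 * (F.P K).L ^ (K - n) + ℓ') : ℤ)) ((2 * (F.P K).L ^ (K - n) + ℓ') : ℤ)),
                    (‖R (holT (unitsField (toUField W)) (embIter (K - n) y) (seg ι ((η : ℕ) : ℤ) ++ treeWord q))
                          ((holT (unitsField (toUField W)) (transl (transl (embIter (K - n) y) (((η : ℕ) : ℤ) • e ι)) q) [((t μ).getD i μ, true), (μ, true), Letter.rev ((t μ).getD i μ, true), (μ, false)] : (Matrix (Fin 2) (Fin 2) ℂ)ˣ) : Matrix (Fin 2) (Fin 2) ℂ)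
                        * φ₀ (embIter (K - n) y)
                      - φ₀ (embIter (K - n) y)
                        * R (holT (unitsField (toUField W)) (embIter (K - n) y) (seg ι ((η : ℕ) : ℤ) ++ treeWord q))
                          ((holT (unitsField (toUField W)) (transl (transl (embIter (K - n) y) (((η : ℕ) : ℤ) • e ι)) q) [((t μ).getD i μ, true), (μ, true), Letter.rev ((t μ).getD i μ, true), (μ, false)] : (Matrix (Fin 2) (Fin 2) ℂ)ˣ) : Matrix (Fin 2) (Fin 2) ℂ)‖ ^ 2
                    + ‖R (holT (unitsField (toUField W)) (embIter (K - n) y) (seg ι ((η : ℕ) : ℤ) ++ treeWord q))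
                          ((holT (unitsField (toUField W)) (transl (transl (embIter (K - n) y) (((η : ℕ) : ℤ) • e ι)) q) [((t μ).getD i μ, false), (μ, true), Letter.rev ((t μ).getD i μ, false), (μ, false)] : (Matrix (Fin 2) (Fin 2) ℂ)ˣ) : Matrix (Fin 2) (Fin 2) ℂ)
                        * φ₀ (embIter (K - n) y)
                      - φ₀ (embIter (K - n) y)
                        * R (holT (unitsField (toUField W)) (embIter (K - n) y) (seg ι ((η : ℕ) : ℤ) ++ treeWord q))
                          ((holT (unitsField (toUField W)) (transl (transl (embIter (K - n) y) (((η : ℕ) : ℤ) • e ι)) q) [((t μ).getD i μ, false), (μ, true), Letter.rev ((t μ).getD i μ, false), (μ, false)] : (Matrix (Fin 2) (Fin 2) ℂ)ˣ) : Matrix (Fin 2) (Fin 2) ℂ)‖ ^ 2))))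
        ≤ ζ_D * (∑ p : Plaq (F.P K) 0, ‖((Complex.I • D ⟨p.src, p.μ⟩) + ((W ⟨p.src, p.μ⟩ : Matrix (Fin 2) (Fin 2) ℂ) * (Complex.I • D ⟨p.src.shift p.μ, p.ν⟩) * star (W ⟨p.src, p.μ⟩ : Matrix (Fin 2) (Fin 2) ℂ))
            - (((W ⟨p.src, p.μ⟩ * W ⟨p.src.shift p.μ, p.ν⟩ * (W ⟨p.src.shift p.ν, p.μ⟩)⁻¹ : Matrix.specialUnitaryGroup (Fin 2) ℂ) : Matrix (Fin 2) (Fin 2) ℂ) * (Complex.I • D ⟨p.src.shift p.ν, p.μ⟩) * star ((W ⟨p.src, p.μ⟩ * W ⟨p.src.shift p.μ, p.ν⟩ * (W ⟨p.src.shift p.ν, p.μ⟩)⁻¹ : Matrix.specialUnitaryGroup (Fin 2) ℂ) : Matrix (Fin 2) (Fin 2) ℂ))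
            - (((GaugeField.plaqHol W p : Matrix.specialUnitaryGroup (Fin 2) ℂ) : Matrix (Fin 2) (Fin 2) ℂ) * (Complex.I • D ⟨p.src, p.ν⟩) * star ((GaugeField.plaqHol W p : Matrix.specialUnitaryGroup (Fin 2) ℂ) : Matrix (Fin 2) (Fin 2) ℂ)))‖ ^ 2) + θ_D * ee * (((F.L : ℝ) ^ (K - n)) ^ 2)⁻¹ * (∑ b : PBond (F.P K) 0, ‖D b‖ ^ 2))
    (hLap : (∑ y : Site (F.P K) (K - n), ∑ z : Site (F.P K) 0,
            (if (∀ ν : Fin (F.P K).d,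
                (y ν = (iterBlockOf (K - n) (fun κ => z κ - (((((F.P K).L ^ (K - n) - 1) / 2 : ℕ)) : ZMod ((F.P K).sitesPerDir 0)))) ν - 1
                ∨ y ν = (iterBlockOf (K - n) (fun κ => z κ - (((((F.P K).L ^ (K - n) - 1) / 2 : ℕ)) : ZMod ((F.P K).sitesPerDir 0)))) ν
                ∨ y ν = (iterBlockOf (K - n) (fun κ => z κ - (((((F.P K).L ^ (K - n) - 1) / 2 : ℕ)) : ZMod ((F.P K).sitesPerDir 0)))) ν + 1
                ∨ y ν = (iterBlockOf (K - n) (fun κ => z κ - (((((F.P K).L ^ (K - n) - 1) / 2 : ℕ)) : ZMod ((F.P K).sitesPerDir 0)))) ν + 2))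
              then ‖divB (torusT (F.P K) 0) (fun κ z => unitsField (toUField W) ⟨z, κ⟩)
                (fun μ => covD (torusT (F.P K) 0) (fun κ z => unitsField (toUField W) ⟨z, κ⟩) μ (fun z => (ℓ' : ℝ)⁻¹ • ∑ η : Fin ℓ', R (axialT (unitsField (toUField W)) (transl (embIter (K - n) y) (((η : ℕ) : ℤ) • e ι)) z)⁻¹ (R (holT (unitsField (toUField W)) (embIter (K - n) y) (seg ι ((η : ℕ) : ℤ)))⁻¹ (φ₀ (embIter (K - n) y))))) z‖ ^ 2 else 0)) ≤ A₁ * KGP + A₂ * a ^ 2 * (∑ y : Site (F.P K) (K - n), ∑ z : Site (F.P K) 0,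
              (if (∀ ν : Fin (F.P K).d,
                  (y ν = (iterBlockOf (K - n) (fun κ => z κ - (((((F.P K).L ^ (K - n) - 1) / 2 : ℕ)) : ZMod ((F.P K).sitesPerDir 0)))) ν - 1
                  ∨ y ν = (iterBlockOf (K - n) (fun κ => z κ - (((((F.P K).L ^ (K - n) - 1) / 2 : ℕ)) : ZMod ((F.P K).sitesPerDir 0)))) ν
                  ∨ y ν = (iterBlockOf (K - n) (fun κ => z κ - (((((F.P K).L ^ (K - n) - 1) / 2 : ℕ)) : ZMod ((F.P K).sitesPerDir 0)))) ν + 1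
                  ∨ y ν = (iterBlockOf (K - n) (fun κ => z κ - (((((F.P K).L ^ (K - n) - 1) / 2 : ℕ)) : ZMod ((F.P K).sitesPerDir 0)))) ν + 2))
                then ∑ μ : Fin (F.P K).d,
                  (‖covDstar (torusT (F.P K) 0) (fun κ z => unitsField (toUField W) ⟨z, κ⟩) μ (fun z => (ℓ' : ℝ)⁻¹ • ∑ η : Fin ℓ', R (axialT (unitsField (toUField W)) (transl (embIter (K - n) y) (((η : ℕ) : ℤ) • e ι)) z)⁻¹ (R (holT (unitsField (toUField W)) (embIter (K - n) y) (seg ι ((η : ℕ) : ℤ)))⁻¹ (φ₀ (embIter (K - n) y)))) z‖ ^ 2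
                    + ‖covD (torusT (F.P K) 0) (fun κ z => unitsField (toUField W) ⟨z, κ⟩) μ (fun z => (ℓ' : ℝ)⁻¹ • ∑ η : Fin ℓ', R (axialT (unitsField (toUField W)) (transl (embIter (K - n) y) (((η : ℕ) : ℤ) • e ι)) z)⁻¹ (R (holT (unitsField (toUField W)) (embIter (K - n) y) (seg ι ((η : ℕ) : ℤ)))⁻¹ (φ₀ (embIter (K - n) y)))) z‖ ^ 2) else 0)))
    (hKgP : KGP ≤ Cg' * (∑ p : Plaq (F.P K) 0, ‖((Complex.I • D ⟨p.src, p.μ⟩) + ((W ⟨p.src, p.μ⟩ : Matrix (Fin 2) (Fin 2) ℂ) * (Complex.I • D ⟨p.src.shift p.μ, p.ν⟩) * star (W ⟨p.src, p.μ⟩ : Matrix (Fin 2) (Fin 2) ℂ))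
            - (((W ⟨p.src, p.μ⟩ * W ⟨p.src.shift p.μ, p.ν⟩ * (W ⟨p.src.shift p.ν, p.μ⟩)⁻¹ : Matrix.specialUnitaryGroup (Fin 2) ℂ) : Matrix (Fin 2) (Fin 2) ℂ) * (Complex.I • D ⟨p.src.shift p.ν, p.μ⟩) * star ((W ⟨p.src, p.μ⟩ * W ⟨p.src.shift p.μ, p.ν⟩ * (W ⟨p.src.shift p.ν, p.μ⟩)⁻¹ : Matrix.specialUnitaryGroup (Fin 2) ℂ) : Matrix (Fin 2) (Fin 2) ℂ))
            - (((GaugeField.plaqHol W p : Matrix.specialUnitaryGroup (Fin 2) ℂ) : Matrix (Fin 2) (Fin 2) ℂ) * (Complex.I • D ⟨p.src, p.ν⟩) * star ((GaugeField.plaqHol W p : Matrix.specialUnitaryGroup (Fin 2) ℂ) : Matrix (Fin 2) (Fin 2) ℂ)))‖ ^ 2) + θg' * ee * (((F.L : ℝ) ^ (K - n)) ^ 2)⁻¹ * (∑ b : PBond (F.P K) 0, ‖D b‖ ^ 2))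
    (hJunc : 2 * (3 * (((F.P K).d : ℝ) * (24 / ((((F.P K).L ^ (K - n) : ℕ) : ℝ)) ^ 2) ^ 2))
          * (((F.P K).d : ℝ) * ∑ y : Site (F.P K) (K - n), ∑ z : Site (F.P K) 0,
      (if (∀ ν : Fin (F.P K).d,
          (y ν = (iterBlockOf (K - n) (fun κ => z κ - (((((F.P K).L ^ (K - n) - 1) / 2 : ℕ)) : ZMod ((F.P K).sitesPerDir 0)))) ν - 1
          ∨ y ν = (iterBlockOf (K - n) (fun κ => z κ - (((((F.P K).L ^ (K - n) - 1) / 2 : ℕ)) : ZMod ((F.P K).sitesPerDir 0)))) ν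
          ∨ y ν = (iterBlockOf (K - n) (fun κ => z κ - (((((F.P K).L ^ (K - n) - 1) / 2 : ℕ)) : ZMod ((F.P K).sitesPerDir 0)))) ν + 1
          ∨ y ν = (iterBlockOf (K - n) (fun κ => z κ - (((((F.P K).L ^ (K - n) - 1) / 2 : ℕ)) : ZMod ((F.P K).sitesPerDir 0)))) ν + 2))
        then (ℓ' : ℝ)⁻¹ * ∑ η : Fin ℓ', 2 * (‖R (S y z) (φ₀ (embIter (K - n) y)) - φ₀ (embIter (K - n) (iterBlockOf (K - n) (fun κ => z κ - (((((F.P K).L ^ (K - n) - 1) / 2 : ℕ)) : ZMod ((F.P K).sitesPerDir 0)))))‖ ^ 2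
            + ‖(((S y z)⁻¹ * holT (unitsField (toUField W)) (embIter (K - n) (iterBlockOf (K - n) (fun κ => z κ - (((((F.P K).L ^ (K - n) - 1) / 2 : ℕ)) : ZMod ((F.P K).sitesPerDir 0))))) (seg ι ((η : ℕ) : ℤ) ++ treeWord (rel (transl (embIter (K - n) (iterBlockOf (K - n) (fun κ => z κ - (((((F.P K).L ^ (K - n) - 1) / 2 : ℕ)) : ZMod ((F.P K).sitesPerDir 0))))) (((η : ℕ) : ℤ) • e ι)) z)) * (holT (unitsField (toUField W)) (embIter (K - n) y) (seg ι ((η : ℕ) : ℤ) ++ treeWord (rel (transl (embIter (K - n) y) (((η : ℕ) : ℤ) • e ι)) z)))⁻¹ : (Matrix (Fin 2) (Fin 2) ℂ)ˣ) : Matrix (Fin 2) (Fin 2) ℂ) * φ₀ (embIter (K - n) y)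
                - φ₀ (embIter (K - n) y) * (((S y z)⁻¹ * holT (unitsField (toUField W)) (embIter (K - n) (iterBlockOf (K - n) (fun κ => z κ - (((((F.P K).L ^ (K - n) - 1) / 2 : ℕ)) : ZMod ((F.P K).sitesPerDir 0))))) (seg ι ((η : ℕ) : ℤ) ++ treeWord (rel (transl (embIter (K - n) (iterBlockOf (K - n) (fun κ => z κ - (((((F.P K).L ^ (K - n) - 1) / 2 : ℕ)) : ZMod ((F.P K).sitesPerDir 0))))) (((η : ℕ) : ℤ) • e ι)) z)) * (holT (unitsField (toUField W)) (embIter (K - n) y) (seg ι ((η : ℕ) : ℤ) ++ treeWord (rel (transl (embIter (K - n) y) (((η : ℕ) : ℤ) • e ι)) z)))⁻¹ : (Matrix (Fin 2) (Fin 2) ℂ)ˣ) : Matrix (Fin 2) (Fin 2) ℂ)‖ ^ 2) else 0))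
        ≤ C_H * ((F.L : ℝ) ^ (K - n))⁻¹ * (∑ c : PBond (F.P K) (K - n), ∑ a : Fin 2, ∑ b : Fin 2,
                Complex.normSq ((φ₀ (embIter (K - n) c.src) - ((Averaging.iter (fun i => blockAvg (P := F.P K) (j := i) (expMeanLogSU (n := Fin 2))) (K - n) W c : Matrix.specialUnitaryGroup (Fin 2) ℂ) : Matrix (Fin 2) (Fin 2) ℂ)
                    * φ₀ (embIter (K - n) c.tgt) * star ((Averaging.iter (fun i => blockAvg (P := F.P K) (j := i) (expMeanLogSU (n := Fin 2))) (K - n) W c : Matrix.specialUnitaryGroup (Fin 2) ℂ) : Matrix (Fin 2) (Fin 2) ℂ)) a b)) + ζ_G * (∑ p : Plaq (F.P K) 0, ‖((Complex.I • D ⟨p.src, p.μ⟩) + ((W ⟨p.src, p.μ⟩ : Matrix (Fin 2) (Fin 2) ℂ) * (Complex.I • D ⟨p.src.shift p.μ, p.ν⟩) * star (W ⟨p.src, p.μ⟩ : Matrix (Fin 2) (Fin 2) ℂ))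
            - (((W ⟨p.src, p.μ⟩ * W ⟨p.src.shift p.μ, p.ν⟩ * (W ⟨p.src.shift p.ν, p.μ⟩)⁻¹ : Matrix.specialUnitaryGroup (Fin 2) ℂ) : Matrix (Fin 2) (Fin 2) ℂ) * (Complex.I • D ⟨p.src.shift p.ν, p.μ⟩) * star ((W ⟨p.src, p.μ⟩ * W ⟨p.src.shift p.μ, p.ν⟩ * (W ⟨p.src.shift p.ν, p.μ⟩)⁻¹ : Matrix.specialUnitaryGroup (Fin 2) ℂ) : Matrix (Fin 2) (Fin 2) ℂ))
            - (((GaugeField.plaqHol W p : Matrix.specialUnitaryGroup (Fin 2) ℂ) : Matrix (Fin 2) (Fin 2) ℂ) * (Complex.I • D ⟨p.src, p.ν⟩) * star ((GaugeField.plaqHol W p : Matrix.specialUnitaryGroup (Fin 2) ℂ) : Matrix (Fin 2) (Fin 2) ℂ)))‖ ^ 2) + θ_G * ee * (((F.L : ℝ) ^ (K - n)) ^ 2)⁻¹ * (∑ b : PBond (F.P K) 0, ‖D b‖ ^ 2)) :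
    ((∑ x : Site (F.P K) 0, ∑ a : Fin 2, ∑ b : Fin 2,
                Complex.normSq ((divB (torusT (F.P K) 0) (fun κ z => unitsField (toUField W) ⟨z, κ⟩)
                  (fun κ y => covD (torusT (F.P K) 0) (fun κ z => unitsField (toUField W) ⟨z, κ⟩) κ φ₀ y) x) a b))
              ≤ C_H * ((F.L : ℝ) ^ (K - n))⁻¹ * (∑ c : PBond (F.P K) (K - n), ∑ a : Fin 2, ∑ b : Fin 2,
                Complex.normSq ((φ₀ (embIter (K - n) c.src) - ((Averaging.iter (fun i => blockAvg (P := F.P K) (j := i) (expMeanLogSU (n := Fin 2))) (K - n) W c : Matrix.specialUnitaryGroup (Fin 2) ℂ) : Matrix (Fin 2) (Fin 2) ℂ)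
                    * φ₀ (embIter (K - n) c.tgt) * star ((Averaging.iter (fun i => blockAvg (P := F.P K) (j := i) (expMeanLogSU (n := Fin 2))) (K - n) W c : Matrix.specialUnitaryGroup (Fin 2) ℂ) : Matrix (Fin 2) (Fin 2) ℂ)) a b))
                + (6 * (A₁ * Cg' + A₂ * ζ_D) + ζ_D + ζ_G) * (∑ p : Plaq (F.P K) 0, ‖((Complex.I • D ⟨p.src, p.μ⟩) + ((W ⟨p.src, p.μ⟩ : Matrix (Fin 2) (Fin 2) ℂ) * (Complex.I • D ⟨p.src.shift p.μ, p.ν⟩) * star (W ⟨p.src, p.μ⟩ : Matrix (Fin 2) (Fin 2) ℂ))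
            - (((W ⟨p.src, p.μ⟩ * W ⟨p.src.shift p.μ, p.ν⟩ * (W ⟨p.src.shift p.ν, p.μ⟩)⁻¹ : Matrix.specialUnitaryGroup (Fin 2) ℂ) : Matrix (Fin 2) (Fin 2) ℂ) * (Complex.I • D ⟨p.src.shift p.ν, p.μ⟩) * star ((W ⟨p.src, p.μ⟩ * W ⟨p.src.shift p.μ, p.ν⟩ * (W ⟨p.src.shift p.ν, p.μ⟩)⁻¹ : Matrix.specialUnitaryGroup (Fin 2) ℂ) : Matrix (Fin 2) (Fin 2) ℂ))
            - (((GaugeField.plaqHol W p : Matrix.specialUnitaryGroup (Fin 2) ℂ) : Matrix (Fin 2) (Fin 2) ℂ) * (Complex.I • D ⟨p.src, p.ν⟩) * star ((GaugeField.plaqHol W p : Matrix.specialUnitaryGroup (Fin 2) ℂ) : Matrix (Fin 2) (Fin 2) ℂ)))‖ ^ 2)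
                + (6 * (A₁ * θg' + A₂ * θ_D) + θ_D + θ_G) * ee * (((F.L : ℝ) ^ (K - n)) ^ 2)⁻¹ * (∑ b : PBond (F.P K) 0, ‖D b‖ ^ 2)) ∧
    ((∑ c : PBond (F.P K) (K - n), ∑ a : Fin 2, ∑ b : Fin 2,
                Complex.normSq ((φ₀ (embIter (K - n) c.src) - ((Averaging.iter (fun i => blockAvg (P := F.P K) (j := i) (expMeanLogSU (n := Fin 2))) (K - n) W c : Matrix.specialUnitaryGroup (Fin 2) ℂ) : Matrix (Fin 2) (Fin 2) ℂ)
                    * φ₀ (embIter (K - n) c.tgt) * star ((Averaging.iter (fun i => blockAvg (P := F.P K) (j := i) (expMeanLogSU (n := Fin 2))) (K - n) W c : Matrix.specialUnitaryGroup (Fin 2) ℂ) : Matrix (Fin 2) (Fin 2) ℂ)) a b))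
              ≤ ((F.L : ℝ) ^ (K - n)) * ((ζ_X * (θ + θ_q) / θ) / (θ + θ_q)) * (∑ p : Plaq (F.P K) 0, ‖((Complex.I • D ⟨p.src, p.μ⟩) + ((W ⟨p.src, p.μ⟩ : Matrix (Fin 2) (Fin 2) ℂ) * (Complex.I • D ⟨p.src.shift p.μ, p.ν⟩) * star (W ⟨p.src, p.μ⟩ : Matrix (Fin 2) (Fin 2) ℂ))
            - (((W ⟨p.src, p.μ⟩ * W ⟨p.src.shift p.μ, p.ν⟩ * (W ⟨p.src.shift p.ν, p.μ⟩)⁻¹ : Matrix.specialUnitaryGroup (Fin 2) ℂ) : Matrix (Fin 2) (Fin 2) ℂ) * (Complex.I • D ⟨p.src.shift p.ν, p.μ⟩) * star ((W ⟨p.src, p.μ⟩ * W ⟨p.src.shift p.μ, p.ν⟩ * (W ⟨p.src.shift p.ν, p.μ⟩)⁻¹ : Matrix.specialUnitaryGroup (Fin 2) ℂ) : Matrix (Fin 2) (Fin 2) ℂ))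
            - (((GaugeField.plaqHol W p : Matrix.specialUnitaryGroup (Fin 2) ℂ) : Matrix (Fin 2) (Fin 2) ℂ) * (Complex.I • D ⟨p.src, p.ν⟩) * star ((GaugeField.plaqHol W p : Matrix.specialUnitaryGroup (Fin 2) ℂ) : Matrix (Fin 2) (Fin 2) ℂ)))‖ ^ 2)
                + (θ + θ_q) * ((F.L : ℝ) ^ (K - n))⁻¹ * (∑ b : PBond (F.P K) 0, ‖D b‖ ^ 2)
                + (θ_X + 64 * ((4770 * (F.L : ℝ) ^ 3) ^ 2 * ((5 * (F.L : ℝ)) ^ 2 / 2) ^ 2 / 4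
              + (2 * (5 * (F.L : ℝ)) ^ 3 / ((F.L : ℝ) * ((F.L : ℝ) - 1) * ((F.L : ℝ) ^ 2 - 1)) + (2 * (5 * (F.L : ℝ)) + 2 * 3 + 1) ^ 2 / 2) ^ 2)
              + 768000000000 * (F.L : ℝ) ^ 9) * ee * ((F.L : ℝ) ^ (K - n))⁻¹ * (∑ b : PBond (F.P K) 0, ‖D b‖ ^ 2)
                + (C_X + 8) * ((F.L : ℝ) ^ (K - n)) * (∑ b : PBond (F.P K) 0, ∑ ν : Fin (F.P K).d,
                ‖((W ⟨b.src, ν⟩ : Matrix.specialUnitaryGroup (Fin 2) ℂ) : Matrix (Fin 2) (Fin 2) ℂ) * B ⟨b.src.shift ν, b.dir⟩ * star ((W ⟨b.src, ν⟩ : Matrix.specialUnitaryGroup (Fin 2) ℂ) : Matrix (Fin 2) (Fin 2) ℂ) - B b‖ ^ 2)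
                + 19200 * (F.L : ℝ) ^ 4 * ((F.L : ℝ) ^ (K - n)) * (∑ x : Site (F.P K) 0, ∑ μ : Fin (F.P K).d, ∑ ν : Fin (F.P K).d,
                (if μ < ν then ∑ j : Fin 2, ∑ k : Fin 2, ‖(curl (torusT (F.P K) 0) (fun κ z => unitsField (toUField W) ⟨z, κ⟩) (fun κ z => B ⟨z, κ⟩) μ ν x) j k‖ ^ 2 else 0))
                + (η_X + η_q) * ((F.L : ℝ) ^ (K - n)) * (∑ x : Site (F.P K) 0, ∑ j : Fin 2, ∑ k : Fin 2,
              ‖(divB (torusT (F.P K) 0) (fun κ z => unitsField (toUField W) ⟨z, κ⟩) (fun κ z => Complex.I • D ⟨z, κ⟩) x) j k‖ ^ 2)) ∧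
    ((∑ b : PBond (F.P K) 0, ∑ ν : Fin (F.P K).d,
                ‖((W ⟨b.src, ν⟩ : Matrix.specialUnitaryGroup (Fin 2) ℂ) : Matrix (Fin 2) (Fin 2) ℂ) * B ⟨b.src.shift ν, b.dir⟩ * star ((W ⟨b.src, ν⟩ : Matrix.specialUnitaryGroup (Fin 2) ℂ) : Matrix (Fin 2) (Fin 2) ℂ) - B b‖ ^ 2)
                + (∑ x : Site (F.P K) 0, ∑ μ : Fin (F.P K).d, ∑ ν : Fin (F.P K).d,
                (if μ < ν then ∑ j : Fin 2, ∑ k : Fin 2, ‖(curl (torusT (F.P K) 0) (fun κ z => unitsField (toUField W) ⟨z, κ⟩) (fun κ z => B ⟨z, κ⟩) μ ν x) j k‖ ^ 2 else 0))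
              ≤ (16 * (1 + C_g)) * (∑ p : Plaq (F.P K) 0, ‖((Complex.I • D ⟨p.src, p.μ⟩) + ((W ⟨p.src, p.μ⟩ : Matrix (Fin 2) (Fin 2) ℂ) * (Complex.I • D ⟨p.src.shift p.μ, p.ν⟩) * star (W ⟨p.src, p.μ⟩ : Matrix (Fin 2) (Fin 2) ℂ))
            - (((W ⟨p.src, p.μ⟩ * W ⟨p.src.shift p.μ, p.ν⟩ * (W ⟨p.src.shift p.ν, p.μ⟩)⁻¹ : Matrix.specialUnitaryGroup (Fin 2) ℂ) : Matrix (Fin 2) (Fin 2) ℂ) * (Complex.I • D ⟨p.src.shift p.ν, p.μ⟩) * star ((W ⟨p.src, p.μ⟩ * W ⟨p.src.shift p.μ, p.ν⟩ * (W ⟨p.src.shift p.ν, p.μ⟩)⁻¹ : Matrix.specialUnitaryGroup (Fin 2) ℂ) : Matrix (Fin 2) (Fin 2) ℂ))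
            - (((GaugeField.plaqHol W p : Matrix.specialUnitaryGroup (Fin 2) ℂ) : Matrix (Fin 2) (Fin 2) ℂ) * (Complex.I • D ⟨p.src, p.ν⟩) * star ((GaugeField.plaqHol W p : Matrix.specialUnitaryGroup (Fin 2) ℂ) : Matrix (Fin 2) (Fin 2) ℂ)))‖ ^ 2)
                + (16 * θ_g + 792) * ee * (((F.L : ℝ) ^ (K - n)) ^ 2)⁻¹ * (∑ b : PBond (F.P K) 0, ‖D b‖ ^ 2)) := by
  refine ⟨?_, ?_, ?_⟩
  · -- ROW (H): ✓`rowH_of_localModelRows_pt` ∘ ✓`rowsH_of_offsetFamilyRows`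
    have h := rowH_of_localModelRows_pt F K n hk hℓ2 W φ₀ hψ
      (rowsH_of_offsetFamilyRows F K n hk W φ₀ ι ℓ' hN s t hsplit' hs ht S hS hA₁ hA₂ ha hKgPfam hLap hKgP hJunc)
    exact h
  · -- ROW (P′): px5's ✓`rowP_of_faceFluxRows` + the free-θ reparametrisation
    have hP := rowP_of_faceFluxRows F n K W he heL hW D B φ₀ hsplit hBc Q hQ0 hQs hq hXb
    have hθ0 : θ ≠ 0 := hθ.ne'
    have hθq : θ + θ_q ≠ 0 := hθq0.ne'
    have e1 : ζ_X * (θ + θ_q) / θ / (θ + θ_q) = ζ_X / θ := by field_simp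
    rw [e1]
    exact hP
  · -- ROW (B): px12's ✓`rowB_of_hKgK_T3`
    have hKg' := hKg (fun b => covD (torusT (F.P K) 0) (fun κ z => unitsField (toUField W) ⟨z, κ⟩) b.dir φ₀ b.src) (fun _ => rfl)
    exact rowB_of_hKgK_T3 F K n W he.le he1 hW D B φ₀ hsplit hBc (fun b => covD (torusT (F.P K) 0) (fun κ z => unitsField (toUField W) ⟨z, κ⟩) b.dir φ₀ b.src) (fun _ => rfl) hKg'

end Summit.QuantumFields.YangMills.Theorems.Prop7EngineRowsOfRawRows

end
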